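import Summits.BirchSwinnertonDyer.BirchSwinnertonDyer.Theorems.SignedLowerHalvesSmallImageLowerHalfBothSignsRttD2OZetaFamily
import Summits.BirchSwinnertonDyer.BirchSwinnertonDyer.Theorems.PrintCf2RubinValueTwoTwistedIwasawaDataExist
import Literature.NumberTheory.ComplexMultiplication.EllipticUnits.ImaginaryQuadraticMainConjectureCarriersOGroupElt
import HarnessLib

/-!
# Route `SignedLowerHalves`, crux L `SmallImageLowerHalfBothSigns` (stmt-BirchSwinnertonDyer-23599), line `rtt_w3` — row D2-O-EXIST,
# UNIT HALF, FILE 2: EXISTENCE OF THE PINNED `𝒪`-DATUM — `Nonempty (JohnsonLeungKings2011.TwistedIwasawaDataO S κ₁ κ₂ γ₁ γ₂ θ 𝔣 ι)`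
# with PRESCRIBED carriers, conditional on the prints (E) Kato §15.5, (O1) de Shalit II.2.5 (i) + II.2.4 (i), (O2) de Shalit II.2.4 (ii)

INPUTS hand `bsd-inputs-honda-p1` g22 (prover-bsd-inputs-honda-p1-g22-0) for LEAD `cruxlead-stmt-BirchSwinnertonDyer-23599` g9 (cell
`bsd-ssimc`); ROUTE-INDEPENDENT helper (`--supports stmt-BirchSwinnertonDyer-23599`); THEOREMS ONLY — no definition, no named fact, no
instance, no `sorry`. The `𝒪 = 𝒪_{ℚ_p(S)}`-coefficient twin of route C's `…Theorems.PrintCf2.TwistedZeta.exists_twistedIwasawaData`.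
HONEST FRAMING: this makes the HYPOTHESIS STRUCTURE of honda g22's named fact `cor53_thm52ShapeO` ([JLK] Cor. 5.3 for `𝒪`-valued `χ`)
INHABITED under the prints; Cor. 5.3 itself remains a named fact; nothing here closes the crux; BSD is not proved by any of this.

WHAT.
* **`exists_twistedIwasawaDataO`** — for `K` imaginary quadratic, `ι`, `p`, a generator pair `(γ₁, γ₂)` of `Gal(K̃_∞/K)` UP TO UNITS,
  `θ : Γ_K → 𝒪ˣ` trivial on `Gal(K̄/K(𝔣))`, `𝔣 ≠ 0`, and ANY three carriers `I0, I1, I2 : IwasawaCohomologyDataO …` (e.g. honda g22's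
  `iwasawaCohomologyDataO`): `∃ D : TwistedIwasawaDataO S κ₁ κ₂ γ₁ γ₂ θ 𝔣 ι, D.D0 = I0 ∧ D.D1 = I1 ∧ D.D2 = I2`. The pins: (A1) = route C's
  `exists_artin_exponents_of_unitTwist` (character-free); `aZeta a` = the element of `I1.H = lim←_{n,k}` given by the compatible `𝒪`-zeta
  family of FILE 1 ((P4)); (Z1) = FILE 1 (ii); (Z2) = `proj`-wise (P3): at a common large Kato level `s`, honda g22's `proj_nsubEltO_smul` +
  `relCoresO_levelConjO` / `relCoresO_levelScalarO` reduce it to FILE 1 (iii) (route C's `indep_at_katoLevel` at `θ₀ = 1` pushed through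
  `⊗ t_p(χ)` with the conjugation law `conj_γ (T c) = θ(γ) · T(conj_γ c)`).
* **`nonempty_twistedIwasawaDataO`**, **`twistedIwasawaDataOExists_of_prints`** — the closed `∀`-form with honda g22's carriers;
* `exists_pos_forall_pow_apply_eq_one` (`hθ` of the fact from `hθ𝔣`) and the ONE-CALL consumer form **`exists_twistedIwasawaDataO_thm52Shape`**
  (prints + `h53 : cor53_thm52ShapeO` ⇒ a datum on the given carriers with `Module.Finite` `H¹`, `H²` and `Thm52Shape`).

References: J. Johnson-Leung, G. Kings (2011) Def. 3.2, Prop. 3.3, §3.3 (5)–(6), Def. 3.5, §4.2 Def. 4.2 (94), §5.1–5.2, Cor. 5.3; K. Kato,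
Astérisque 295 (2004) §15.5–15.6; A. Burungale, M. Flach (2024) §3.2, §4.1 Lemma 7; E. de Shalit (1987) II.2.4–II.2.5.
-/

noncomputable section

open scoped Classical

-- the summit namespace `Summit.BirchSwinnertonDyer.BirchSwinnertonDyer` repeats the problem name by design (D-0017)
set_option linter.dupNamespace false
set_option autoImplicit false

open scoped NumberField
open Field IsDedekindDomain
open Literature.NumberTheory.NumberFields (rayClassField)
open Literature.NumberTheory.GaloisRepresentations Literature.NumberTheory.GaloisRepresentations.DiscreteGaloisModule
open Literature.NumberTheory.EllipticCurves
open Literature.NumberTheory.ComplexMultiplication.EllipticUnits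
open Literature.NumberTheory.ComplexMultiplication.EllipticUnits.JohnsonLeungKings2011
open Summit.BirchSwinnertonDyer.BirchSwinnertonDyer.Theorems.PrintCf2.TwistedZeta

namespace Summit.BirchSwinnertonDyer.BirchSwinnertonDyer.Theorems.SmallImageRttD2OUnits

variable {K : Type} [Field K] [NumberField K] (p : ℕ) [Fact p.Prime] (S : Set (PadicAlgCl p))
  (θ : absoluteGaloisGroup K →ₜ* (padicCoeffIntegers S)ˣ) (𝔣 : Ideal (𝓞 K)) {κ₁ κ₂ : ZpExtension K p} {γ₁ γ₂ : absoluteGaloisGroup K}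

/-- **EXISTENCE OF THE PINNED `𝒪`-DATUM with prescribed carriers.** For `K` imaginary quadratic, `ι : K → ℂ`, `p`, a pair `(κ₁, κ₂)` of
`ℤ_p`-extensions with a topological generator pair `(γ₁, γ₂)` up to units, `θ : Γ_K → 𝒪ˣ` trivial on `Gal(K̄/K(𝔣))`, `𝔣 ≠ 0`, and any
three pinned `𝒪`-carriers `I0, I1, I2`, the prints (E), (O1), (O2) give a `TwistedIwasawaDataO` with `D0 = I0`, `D1 = I1`, `D2 = I2`:
(A1) by route C's `exists_artin_exponents_of_unitTwist`; `aZeta a ∈ I1.H` the element with components the `𝒪`-zeta family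
`(cor_{K(p^s𝔣)/K̃_n}(Kummer_k(ζ_{p^s𝔣}) ⊗ t_p(θ)))_{n,k}` of FILE 1 ((P4)); (Z1) by construction; (Z2) `(N𝔟 − σ_𝔟)·_𝔞ζ = (N𝔞 − σ_𝔞)·_𝔟ζ`
checked `proj`-wise ((P3)) at a common large Kato level via `proj_nsubEltO_smul`, `relCoresO_levelConjO`, `relCoresO_levelScalarO` and
FILE 1 (iii). [cite: JohnsonLeungKings2011, Def. 3.2, Prop. 3.3 (2)(3), Def. 3.5, §4.2 Def. 4.2 (94), §5.1–5.2 (arXiv p0009:L55–95, p0010:L55–80, p0012:L80–112, p0014:L12–112)] [cite: Kato2004Asterisque, §15.5 (p. 253), §15.6 (p. 254)] [cite: BurungaleFlach2024, §3.2 and §4.1 Lemma 7 (arXiv p0013:L30–36, p0017:L50–68)] -/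
theorem exists_twistedIwasawaDataO (hE : Kato2004.sec155_exists_katoUnitRep) (h24i : DeShalit1987.prop24_i_mem_rayClassField)
    (h24ii : DeShalit1987.prop24_ii_galoisAction) (h25 : DeShalit1987.prop25_i_normRelation) (hK : IsImaginaryQuadratic K)
    (ι : K →+* ℂ) (hγ : ∃ u₁ u₂ : ℤ_[p]ˣ, ZpExtension.IsTopGeneratorPair (κ₁.unitTwist u₁) (κ₂.unitTwist u₂) γ₁ γ₂) (h𝔣 : 𝔣 ≠ ⊥)
    (hθ𝔣 : ∀ σ ∈ absGaloisFixingSubgroup (rayClassField K 𝔣), θ σ = 1) (I0 : IwasawaCohomologyDataO S κ₁ κ₂ γ₁ γ₂ θ 𝔣 0)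
    (I1 : IwasawaCohomologyDataO S κ₁ κ₂ γ₁ γ₂ θ 𝔣 1) (I2 : IwasawaCohomologyDataO S κ₁ κ₂ γ₁ γ₂ θ 𝔣 2) :
    ∃ D : TwistedIwasawaDataO S κ₁ κ₂ γ₁ γ₂ θ 𝔣 ι, D.D0 = I0 ∧ D.D1 = I1 ∧ D.D2 = I2 := by
  haveI : NumberField.IsTotallyComplex K := hK.2
  -- (A1)
  obtain ⟨x₁, x₂, hart⟩ := exists_artin_exponents_of_unitTwist p 𝔣 h𝔣 hγ
  -- the `𝒪`-zeta family and its system of representatives, roots and classes (trivial auxiliary `ℤ_p`-character)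
  obtain ⟨s₀, u, β, c, y, hs₀, hu, hβ, hc, hy, hyc, hindep⟩ :=
    exists_zetaFamilyO p S (1 : absoluteGaloisGroup K →ₜ* ℤ_[p]ˣ) θ 𝔣 κ₁ κ₂ hE h25 h24i h24ii hK ι h𝔣 (fun _ ↦ rfl) hθ𝔣
  -- `_𝔞ζ ∈ H¹ = lim←` ((P4))
  choose z hz using fun a ↦ I1.proj_surjective (y a) (hy a)
  refine ⟨
    { D0 := I0, D1 := I1, D2 := I2, artin₁ := x₁, artin₂ := x₂, artin_spec := hart, aZeta := z
      aZeta_proj := fun a n k ↦ ?_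
      aZeta_indep := fun a b ↦ ?_ }, rfl, rfl, rfl⟩
  · -- (Z1)
    refine ⟨max s₀ (k + 2), fun s hs hle ↦ ⟨u a s, β a s k, c a s k, hu a s (le_of_max_le_left hs), hβ a s k, hc a s k, ?_⟩⟩
    rw [hz]
    exact hyc a n k s (le_of_max_le_left hs) (le_of_max_le_right hs) hle
  · -- (Z2), `proj`-wise ((P3))
    rw [← sub_eq_zero]
    refine I1.proj_injective _ fun n k ↦ ?_
    rw [map_sub, sub_eq_zero]
    obtain ⟨sa, hsa⟩ := hart a n
    obtain ⟨sb, hsb⟩ := hart b n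
    obtain ⟨sL, hsL⟩ := exists_katoLevelSubgroup_le_pairLayerSubgroup 𝔣 h𝔣 κ₁ κ₂ n
    -- a common large Kato level
    obtain ⟨s, hsas, hsbs, hsLs, hs0, hk2⟩ : ∃ s, sa ≤ s ∧ sb ≤ s ∧ sL ≤ s ∧ s₀ ≤ s ∧ k + 2 ≤ s :=
      ⟨sa + sb + sL + s₀ + k + 2, by omega, by omega, by omega, by omega, by omega⟩
    have hle : katoLevelSubgroup p 𝔣 s ≤ JohnsonLeungKings2011.pairLayerSubgroup κ₁ κ₂ n :=
      (katoLevelSubgroup_antitone p 𝔣 h𝔣 hsLs).trans hsL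
    rw [I1.proj_nsubEltO_smul one_le_two b (hsb s hsbs hle) k (z a), I1.proj_nsubEltO_smul one_le_two a (hsa s hsas hle) k (z b),
      hz, hz, hyc a n k s hs0 hk2 hle, hyc b n k s hs0 hk2 hle]
    -- push the identity down to the Kato level `U_s`
    have push : ∀ (m : ℤ) (d : padicCoeffIntegers S) (γ : absoluteGaloisGroup K)
        (cc : levelCohO S (suppPF p 𝔣) θ (katoLevelSubgroup p 𝔣 s) k 1),
        m • relCoresO S (suppPF p 𝔣) θ hle (JohnsonLeungKings2011.isOpen_pairLayerSubgroup κ₁ κ₂ n)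
              (isOpen_absGaloisFixingSubgroup K (katoLayer p 𝔣 s)) k 1 cc -
          layerScalarO S κ₁ κ₂ θ 𝔣 n k 1 d (layerConjO S κ₁ κ₂ θ 𝔣 n k 1 γ
            (relCoresO S (suppPF p 𝔣) θ hle (JohnsonLeungKings2011.isOpen_pairLayerSubgroup κ₁ κ₂ n)
              (isOpen_absGaloisFixingSubgroup K (katoLayer p 𝔣 s)) k 1 cc)) =
          relCoresO S (suppPF p 𝔣) θ hle (JohnsonLeungKings2011.isOpen_pairLayerSubgroup κ₁ κ₂ n)
              (isOpen_absGaloisFixingSubgroup K (katoLayer p 𝔣 s)) k 1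
            (m • cc - levelScalarO S (suppPF p 𝔣) θ (katoLevelSubgroup p 𝔣 s) k 1 d
              (levelConjO S (suppPF p 𝔣) θ (katoLevelSubgroup p 𝔣 s) k 1 γ cc)) := by
      intro m d γ cc
      rw [map_sub, map_zsmul, relCoresO_levelScalarO, relCoresO_levelConjO]
      rfl
    rw [push, push]
    exact congrArg _ (hindep a b s k hs0 hk2)

/-- **`Nonempty (TwistedIwasawaDataO S κ₁ κ₂ γ₁ γ₂ θ 𝔣 ι)`** under the same hypotheses, with honda g22's constructed carriers
`iwasawaCohomologyDataO` (`…CarriersOExist`, `iwasawaCohomologyDataOExists`).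
[cite: JohnsonLeungKings2011, §4.2 Def. 4.2 (94) and §5.1–5.2 (arXiv p0012:L80–112, p0014:L12–112)] [cite: Kato2004Asterisque, §15.5 (p. 253)] -/
theorem nonempty_twistedIwasawaDataO (hE : Kato2004.sec155_exists_katoUnitRep) (h24i : DeShalit1987.prop24_i_mem_rayClassField)
    (h24ii : DeShalit1987.prop24_ii_galoisAction) (h25 : DeShalit1987.prop25_i_normRelation) (hK : IsImaginaryQuadratic K)
    (ι : K →+* ℂ) (hγ : ∃ u₁ u₂ : ℤ_[p]ˣ, ZpExtension.IsTopGeneratorPair (κ₁.unitTwist u₁) (κ₂.unitTwist u₂) γ₁ γ₂) (h𝔣 : 𝔣 ≠ ⊥)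
    (hθ𝔣 : ∀ σ ∈ absGaloisFixingSubgroup (rayClassField K 𝔣), θ σ = 1) :
    Nonempty (TwistedIwasawaDataO S κ₁ κ₂ γ₁ γ₂ θ 𝔣 ι) := by
  obtain ⟨D, -⟩ := exists_twistedIwasawaDataO p S θ 𝔣 hE h24i h24ii h25 hK ι hγ h𝔣 hθ𝔣
    (iwasawaCohomologyDataO S κ₁ κ₂ γ₁ γ₂ θ 𝔣 (Nat.zero_le 2)) (iwasawaCohomologyDataO S κ₁ κ₂ γ₁ γ₂ θ 𝔣 one_le_two)
    (iwasawaCohomologyDataO S κ₁ κ₂ γ₁ γ₂ θ 𝔣 le_rfl)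
  exact ⟨D⟩

/-- **The closed form** (the `𝒪`-twin of route C's support item F0b `TwistedIwasawaDataExistsOfPrints`): the prints (E) Kato §15.5,
(O1) de Shalit II.2.4 (i) / II.2.5 (i), (O2) de Shalit II.2.4 (ii) — the tree's named facts, as hypotheses — imply, for every imaginary
quadratic `K`, `p`, finite `S ⊆ ℚ̄_p` (coefficients `𝒪 = 𝒪_{ℚ_p(S)}`), pair `(κ₁, κ₂)`, generator pair `(γ₁, γ₂)` up to units,
`θ : Γ_K → 𝒪ˣ` trivial on `Gal(K̄/K(𝔣))`, `𝔣 ≠ 0` and `ι`, that honda g22's pinned datum of [JLK] Cor. 5.3 EXISTS — so that the named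
fact `cor53_thm52ShapeO` has an inhabited hypothesis structure. (Cor. 5.3 itself remains a named fact; nothing about BSD is proved.)
[cite: JohnsonLeungKings2011, Def. 3.2, Prop. 3.3, Def. 3.5, Def. 4.2 (94), §5.1–5.2, Cor. 5.3 (arXiv p0009:L55–95, p0010:L55–80, p0012:L80–112, p0014:L12–112, p0015:L1–20)] [cite: Kato2004Asterisque, §15.5 (p. 253), §15.6 (p. 254)] -/
theorem twistedIwasawaDataOExists_of_prints (hE : Kato2004.sec155_exists_katoUnitRep)
    (h24i : DeShalit1987.prop24_i_mem_rayClassField) (h24ii : DeShalit1987.prop24_ii_galoisAction)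
    (h25 : DeShalit1987.prop25_i_normRelation) :
    ∀ (K : Type) [Field K] [NumberField K] (p : ℕ) [Fact p.Prime] (S : Set (PadicAlgCl p))
      [FiniteDimensional ℚ_[p] (padicCoeffField S)] (κ₁ κ₂ : ZpExtension K p)
      (γ₁ γ₂ : absoluteGaloisGroup K) (θ : absoluteGaloisGroup K →ₜ* (padicCoeffIntegers S)ˣ) (𝔣 : Ideal (𝓞 K)) (ι : K →+* ℂ),
      IsImaginaryQuadratic K →
      (∃ u₁ u₂ : ℤ_[p]ˣ, ZpExtension.IsTopGeneratorPair (κ₁.unitTwist u₁) (κ₂.unitTwist u₂) γ₁ γ₂) →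
      𝔣 ≠ ⊥ → (∀ σ ∈ absGaloisFixingSubgroup (rayClassField K 𝔣), θ σ = 1) →
        Nonempty (TwistedIwasawaDataO S κ₁ κ₂ γ₁ γ₂ θ 𝔣 ι) :=
  fun _ _ _ p _ S _ _ _ _ _ θ 𝔣 ι hK hγ h𝔣 hθ𝔣 ↦ nonempty_twistedIwasawaDataO p S θ 𝔣 hE h24i h24ii h25 hK ι hγ h𝔣 hθ𝔣

/-! ## One-call consumer form for road D: the datum WITH [JLK] Cor. 5.3's conclusion (`cor53_thm52ShapeO` as hypothesis) -/

/-- **The finite-order hypothesis `hθ` of `cor53_thm52ShapeO` follows from `hθ𝔣`**: a continuous character trivial on the open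
subgroup `Gal(K̄/K(𝔣))` (finite index in the compact `Γ_K`) satisfies `θ(σ)^m = 1` with `m = [Γ_K : Gal(K̄/K(𝔣))]` (p776397 reviewer note (a)).
[cite: JohnsonLeungKings2011, §1.1 (characters of `G(𝔣) = Gal(K(𝔣)/K)`, arXiv p0004:L14–34)] [cite: SerreGaloisCohomology1997, I §1.1] -/
theorem exists_pos_forall_pow_apply_eq_one (hθ𝔣 : ∀ σ ∈ absGaloisFixingSubgroup (rayClassField K 𝔣), θ σ = 1) :
    ∃ m : ℕ, 0 < m ∧ ∀ σ : absoluteGaloisGroup K, θ σ ^ m = 1 := by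
  haveI : (absGaloisFixingSubgroup (rayClassField K 𝔣)).FiniteIndex := by
    haveI : DiscreteTopology (absoluteGaloisGroup K ⧸ absGaloisFixingSubgroup (rayClassField K 𝔣)) :=
      QuotientGroup.discreteTopology (isOpen_absGaloisFixingSubgroup K (rayClassField K 𝔣))
    haveI : Finite (absoluteGaloisGroup K ⧸ absGaloisFixingSubgroup (rayClassField K 𝔣)) := finite_of_compact_of_discrete
    exact Subgroup.finiteIndex_of_finite_quotient
  refine ⟨(absGaloisFixingSubgroup (rayClassField K 𝔣)).index, Nat.pos_of_ne_zero Subgroup.FiniteIndex.index_ne_zero,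
    fun σ ↦ ?_⟩
  rw [← map_pow]
  exact hθ𝔣 _ (Subgroup.pow_index_mem _ σ)

/-- **ONE CALL for road D**: under the prints (E), (O1), (O2) AND [JLK] Cor. 5.3 for `𝒪`-valued `χ` (honda g22's named fact
`cor53_thm52ShapeO`, as a hypothesis), for any three pinned `𝒪`-carriers there is a `TwistedIwasawaDataO` on them whose `H¹`, `H²`
are finitely generated over `Λ_𝒪 = 𝒪⟦T₂⟧⟦T₁⟧` and whose zeta skeleton has `Thm52Shape` — the input of -w3 g19's
`charIdeal_specialisation_mul_eq_of_thm52Shape` / the glue's `hK`, for a GENUINE datum. (Nothing about BSD is proved; Cor. 5.3 is NOT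
proved here — it enters as `h53`.) [cite: JohnsonLeungKings2011, Thm. 5.2, Cor. 5.3 (arXiv p0014:L108–118, p0015:L1–20)] [cite: Kato2004Asterisque, §15.5 (p. 253)] -/
theorem exists_twistedIwasawaDataO_thm52Shape [FiniteDimensional ℚ_[p] (padicCoeffField S)] (h53 : cor53_thm52ShapeO)
    (hE : Kato2004.sec155_exists_katoUnitRep) (h24i : DeShalit1987.prop24_i_mem_rayClassField)
    (h24ii : DeShalit1987.prop24_ii_galoisAction) (h25 : DeShalit1987.prop25_i_normRelation) (hK : IsImaginaryQuadratic K)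
    (ι : K →+* ℂ) (hγ : ∃ u₁ u₂ : ℤ_[p]ˣ, ZpExtension.IsTopGeneratorPair (κ₁.unitTwist u₁) (κ₂.unitTwist u₂) γ₁ γ₂) (h𝔣 : 𝔣 ≠ ⊥)
    (hθ𝔣 : ∀ σ ∈ absGaloisFixingSubgroup (rayClassField K 𝔣), θ σ = 1) (I0 : IwasawaCohomologyDataO S κ₁ κ₂ γ₁ γ₂ θ 𝔣 0)
    (I1 : IwasawaCohomologyDataO S κ₁ κ₂ γ₁ γ₂ θ 𝔣 1) (I2 : IwasawaCohomologyDataO S κ₁ κ₂ γ₁ γ₂ θ 𝔣 2) :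
    ∃ D : TwistedIwasawaDataO S κ₁ κ₂ γ₁ γ₂ θ 𝔣 ι, D.D0 = I0 ∧ D.D1 = I1 ∧ D.D2 = I2 ∧
      Module.Finite (IwasawaAlgebraO₂ S) D.D1.H ∧ Module.Finite (IwasawaAlgebraO₂ S) D.D2.H ∧
      (D.toZetaSkeleton (D.nsub_regular (exists_pos_forall_pow_apply_eq_one p S θ 𝔣 hθ𝔣))).Thm52Shape := by
  obtain ⟨D, h0, h1, h2⟩ := exists_twistedIwasawaDataO p S θ 𝔣 hE h24i h24ii h25 hK ι hγ h𝔣 hθ𝔣 I0 I1 I2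
  have h := h53 K p S κ₁ κ₂ γ₁ γ₂ θ 𝔣 ι D hK hγ (exists_pos_forall_pow_apply_eq_one p S θ 𝔣 hθ𝔣) h𝔣 hθ𝔣
  exact ⟨D, h0, h1, h2, h.1, h.2.1, h.2.2⟩

end Summit.BirchSwinnertonDyer.BirchSwinnertonDyer.Theorems.SmallImageRttD2OUnits

end
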